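import Literature.Barriers.AtomisticToContinuum.AnticontinuumLocalizationGeometry3
import HarnessLib

/-!
# De Roeck–Huveneers 2015, §4.2: the cut-offs `θ_x` are symbols of order `0`

`Literature/Barriers/AtomisticToContinuum/` — continuation of `…Geometry3.lean`: the smoothness and
the derivative bounds `|∂^l θ_x| ≤ C δ^{-|l|}` that the convolution definition of `θ_{x,δ,n₂}` (§4.2) of
W. De Roeck, F. Huveneers, CPAM 68 (2015), arXiv:1305.5127 provides and §5.6 uses
("`∂_♯ ϑ_{a,x}, ∂_♯ ϑ_{a,*} ∼ δ^{-1}`"), in the form `IsDeltaSymbol 0 (thetaW r L n₂ x)`. Each factor of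
`ψ_Q` is `blockFn c (δ⁻¹ P ω)` for a smooth compactly supported `blockFn c (u) = step(‖u‖²)` and a
fixed linear map `P`, so every derivative costs exactly `δ^{-1}` (`isDeltaSymbol_comp_smul_clm`).
All proved; no named facts.
-/

noncomputable section

open Function Set Finset Filter Metric WithLp Module
open scoped BigOperators Topology InnerProductSpace ContDiff

namespace Literature.Barriers.AtomisticToContinuum.HeatConduction.RotorChain

open Literature.MathematicalPhysics.KineticTheory.HeatConduction Literature.Analysis.Calculus

variable {m : ℕ}

/-! ### A composition lemma -/

/-- **Symbols from rescaled linear maps**: for a smooth `g` with bounded derivatives of all orders and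
a continuous linear `T`, `(δ, w) ↦ g(δ⁻¹ T w)` is a symbol of order `0`. [folklore] -/
theorem isDeltaSymbol_comp_smul_clm {E' : Type*} [NormedAddCommGroup E'] [NormedSpace ℝ E'] {g : E' → ℝ} (hg : ContDiff ℝ ∞ g)
    (hb : ∀ i : ℕ, ∃ B : ℝ, 0 ≤ B ∧ ∀ u, ‖iteratedFDeriv ℝ i g u‖ ≤ B) (T : (Fin m → ℝ) →L[ℝ] E') :
    IsDeltaSymbol 0 (fun δ (w : Fin m → ℝ) => g (δ⁻¹ • T w)) := by
  have hcomp : ∀ δ : ℝ, (fun w : Fin m → ℝ => g (δ⁻¹ • T w)) = g ∘ ((δ⁻¹ • T : (Fin m → ℝ) →L[ℝ] E') : (Fin m → ℝ) → E') := by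
    intro δ; funext w; simp
  refine ⟨fun δ hδ hδ1 => ?_, fun i => ?_⟩
  · show ContDiff ℝ ∞ (fun w : Fin m → ℝ => g (δ⁻¹ • T w))
    rw [hcomp δ]; exact hg.comp (δ⁻¹ • T).contDiff
  obtain ⟨B, hB, hbi⟩ := hb i
  refine ⟨B * ‖T‖ ^ i, 0, mul_nonneg hB (pow_nonneg (norm_nonneg _) _), fun δ hδ hδ1 w => ?_⟩
  show ‖iteratedFDeriv ℝ i (fun w : Fin m → ℝ => g (δ⁻¹ • T w)) w‖ ≤ _
  rw [hcomp δ, ContinuousLinearMap.iteratedFDeriv_comp_right (δ⁻¹ • T) hg w (natCast_le_infty i), pow_zero,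
    mul_one, zero_add]
  calc ‖(iteratedFDeriv ℝ i g ((δ⁻¹ • T) w)).compContinuousLinearMap fun _ => δ⁻¹ • T‖
      ≤ ‖iteratedFDeriv ℝ i g ((δ⁻¹ • T) w)‖ * ∏ _j : Fin i, ‖δ⁻¹ • T‖ :=
        ContinuousMultilinearMap.norm_compContinuousLinearMap_le _ _
    _ ≤ B * ∏ _j : Fin i, ‖δ⁻¹ • T‖ := by
        gcongr
        exact hbi _
    _ = B * (‖T‖ / δ) ^ i := by
        rw [prod_const, Finset.card_univ, Fintype.card_fin, norm_smul, norm_inv, Real.norm_of_nonneg hδ.le,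
          div_eq_inv_mul]
    _ = B * ‖T‖ ^ i / δ ^ i := by rw [_root_.div_pow]; ring

/-! ### The block profile -/

/-- The smooth radial block profile `u ↦ step(‖u‖²)` with thresholds `c²`, `(c+1)²`. [cite: DeRoeckHuveneers2015, §4.2 (definition of `B_δ(k_1,…,k_p)`, smoothed)] -/
def blockFn (c : ℝ) (u : Euc m) : ℝ := stepDown (c ^ 2) ((c + 1) ^ 2) (‖u‖ ^ 2)

/-- `blockFn` is smooth. [folklore] -/
theorem contDiff_blockFn (c : ℝ) : ContDiff ℝ ∞ (blockFn (m := m) c) :=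
  (contDiff_stepDown _ _).comp (contDiff_norm_sq ℝ)

/-- `blockFn c` vanishes outside the ball of radius `c + 1`. [folklore] -/
theorem blockFn_eq_zero {c : ℝ} (hc : 0 ≤ c) {u : Euc m} (hu : c + 1 ≤ ‖u‖) : blockFn c u = 0 :=
  stepDown_eq_zero (by nlinarith) (pow_le_pow_left₀ (by linarith) hu 2)

/-- `blockFn c` has compact support. [folklore] -/
theorem hasCompactSupport_blockFn {c : ℝ} (hc : 0 ≤ c) : HasCompactSupport (blockFn (m := m) c) := by
  refine HasCompactSupport.of_support_subset_isCompact (isCompact_closedBall (0 : Euc m) (c + 1)) fun u hu => ?_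
  rw [mem_closedBall_zero_iff]
  by_contra h
  exact hu (blockFn_eq_zero hc (not_le.1 h).le)

/-- All derivatives of `blockFn c` are bounded. [folklore] -/
theorem blockFn_deriv_bound {c : ℝ} (hc : 0 ≤ c) (i : ℕ) : ∃ B : ℝ, 0 ≤ B ∧ ∀ u : Euc m, ‖iteratedFDeriv ℝ i (blockFn c) u‖ ≤ B := by
  have hcont : Continuous (iteratedFDeriv ℝ i (blockFn (m := m) c)) :=
    (contDiff_blockFn c).continuous_iteratedFDeriv (natCast_le_infty i)
  have hcs : HasCompactSupport (iteratedFDeriv ℝ i (blockFn (m := m) c)) := (hasCompactSupport_blockFn hc).iteratedFDeriv i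
  obtain ⟨B, hB⟩ := hcont.bounded_above_of_compact_support hcs
  exact ⟨max B 0, le_max_right _ _, fun u => (hB u).trans (le_max_left _ _)⟩

/-- Rescaling the thresholds: `step_{(cδ)², ((c+1)δ)²}(s) = step_{c², (c+1)²}(s/δ²)` (`c ≥ 0`). [folklore] -/
theorem stepDown_rescale {c δ : ℝ} (hc : 0 ≤ c) (hδ : δ ≠ 0) (s : ℝ) :
    stepDown ((c * δ) ^ 2) (((c + 1) * δ) ^ 2) s = stepDown (c ^ 2) ((c + 1) ^ 2) (s / δ ^ 2) := by
  unfold stepDown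
  congr 2
  have hδ2 : δ ^ 2 ≠ 0 := pow_ne_zero 2 hδ
  have h2 : (2 * c + 1) ≠ 0 := by intro h; linarith
  rw [div_eq_div_iff (by intro h; apply h2; nlinarith [sq_nonneg δ, mul_self_pos.2 hδ]) (by intro h; apply h2; nlinarith)]
  field_simp

/-- The factor identity: `step_{(cδ)²,((c+1)δ)²}(‖v‖²) = blockFn c (δ⁻¹ v)` (`δ > 0`). [folklore] -/
theorem stepDown_norm_sq_eq_blockFn {c δ : ℝ} (hc : 0 ≤ c) (hδ : 0 < δ) (v : Euc m) :
    stepDown ((c * δ) ^ 2) (((c + 1) * δ) ^ 2) (‖v‖ ^ 2) = blockFn c (δ⁻¹ • v) := by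
  rw [stepDown_rescale hc hδ.ne', blockFn, norm_smul, norm_inv, Real.norm_of_nonneg hδ.le, mul_pow, inv_pow, div_eq_inv_mul]

/-! ### The symbol property of `ψ_Q` and `θ_x` -/

/-- Momenta to Euclidean momenta, as a continuous linear map. [folklore] -/
def wvecL (m : ℕ) : (Fin m → ℝ) →L[ℝ] Euc m := ((EuclideanSpace.equiv (Fin m) ℝ).symm : (Fin m → ℝ) →L[ℝ] Euc m)

/-- `wvecL w = wvec w`. [folklore] -/
@[simp] theorem wvecL_apply (w : Fin m → ℝ) : wvecL m w = wvec w := rfl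

/-- A block factor is a symbol of order `0`. [cite: DeRoeckHuveneers2015, §4.2 (convolution definition of `θ_{x,δ,n₂}`) and §5.6 ("`∂_♯ ϑ_{a,x}, ∂_♯ ϑ_{a,*} ∼ δ^{-1}`")] -/
theorem isDeltaSymbol_blockFactor {c : ℝ} (hc : 0 ≤ c) (P : Euc m →L[ℝ] Euc m) :
    IsDeltaSymbol 0 (fun δ (w : Fin m → ℝ) => stepDown ((c * δ) ^ 2) (((c + 1) * δ) ^ 2) (‖P (wvec w)‖ ^ 2)) := by
  refine isDeltaSymbol_congr (isDeltaSymbol_comp_smul_clm (contDiff_blockFn c) (blockFn_deriv_bound hc) (P.comp (wvecL m))) (fun δ hδ _ => ?_)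
  funext w
  rw [stepDown_norm_sq_eq_blockFn hc hδ]; rfl

variable {r n₂ : ℕ} {L : ℝ} {x : Fin m}

/-- **`ψ_Q` is a symbol of order `0`.** [cite: DeRoeckHuveneers2015, §4.2 (convolution definition of `θ_{x,δ,n₂}`) and §5.6 ("`∂_♯ ϑ_{a,x}, ∂_♯ ϑ_{a,*} ∼ δ^{-1}`")] -/
theorem isDeltaSymbol_psiQ (hL : 1 ≤ L) {Q : Finset (Fin m → ℤ)} (hQ : IsLI Q) :
    IsDeltaSymbol 0 (fun δ (w : Fin m → ℝ) => psiQ r L Q δ (wvec w)) := by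
  have hmain : IsDeltaSymbol 0 (fun δ (w : Fin m → ℝ) => stepDown ((L ^ Q.card * δ) ^ 2) (((L ^ Q.card + 1) * δ) ^ 2) (dQ Q (wvec w) ^ 2)) :=
    isDeltaSymbol_blockFactor (by positivity) (proj Q)
  have hsub : ∀ Q' ∈ subFamilies r Q, IsDeltaSymbol 0 (fun δ (w : Fin m → ℝ) =>
      stepDown (((L ^ Q.card - L ^ Q'.card) * δ) ^ 2) (((L ^ Q.card - L ^ Q'.card + 1) * δ) ^ 2) (eQ Q Q' (wvec w) ^ 2)) := by
    intro Q' hQ'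
    have := isDeltaSymbol_blockFactor (m := m) (pow_sub_nonneg hL hQ hQ') (proj Q - proj Q')
    simpa [eQ] using this
  have hprod := isDeltaSymbol_prod (subFamilies r Q) hsub
  have := hmain.mul hprod
  simp only [add_zero] at this
  refine isDeltaSymbol_congr this (fun δ _ _ => ?_)
  funext w
  simp only [psiQ]

/-- **`θ_x` is a symbol of order `0`** — smooth with `|∂^l θ_x| ≤ C_l δ^{-|l|}`.
[cite: DeRoeckHuveneers2015, §4.2 (convolution definition of `θ_{x,δ,n₂}`) and §5.6 ("`∂_♯ ϑ_{a,x}, ∂_♯ ϑ_{a,*} ∼ δ^{-1}`")] -/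
theorem isDeltaSymbol_thetaW (hL : 1 ≤ L) : IsDeltaSymbol 0 (thetaW (m := m) r L n₂ x) := by
  have hf : ∀ Q ∈ clusters r n₂ x, IsDeltaSymbol 0 (fun δ (w : Fin m → ℝ) => 1 - psiQ r L Q δ (wvec w)) := fun Q hQ =>
    (IsDeltaSymbol.const 1).sub (isDeltaSymbol_psiQ hL (mem_clusters.1 hQ).1.2.2.1)
  have hprod := isDeltaSymbol_prod (clusters r n₂ x) hf
  refine isDeltaSymbol_congr hprod (fun δ _ _ => ?_)
  funext w
  simp only [thetaW, thetaX]

end Literature.Barriers.AtomisticToContinuum.HeatConduction.RotorChain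

end
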